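import Summits.HodgeConjecture.HodgeConjecture.Theses.NoetherLefschetzOneUp
import Summits.HodgeConjecture.HodgeConjecture.Theorems.NoetherLefschetzOneUpSummitGrantedFourfoldsSketchSector
import Summits.HodgeConjecture.HodgeConjecture.Theorems.NoetherLefschetzOneUpSummitGrantedFourfoldsStubPencilStepCodim
import Literature.AlgebraicGeometry.HodgeTheory.HardLefschetzNFoldHolds
import HarnessLib

/-!
# Crux `SummitGrantedFourfolds` (stmt-HodgeConjecture-14600), line `Sketch` — THE REACH OF HC(4;2,2):
# codimension `≤ 2` and `≥ n − 2` in every dimension; the crux is the band `3 ≤ p ≤ n − 3` (helpers, `--supports`)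

The crux `SummitGrantedFourfolds` of route `NoetherLefschetzOneUp` (rank 4; shared verbatim with
route `CurveNetMordellWeil`) is `HC(4;2,2) → HodgeConjecture` (`Iff.rfl`). Its refuter certificates
record "HC42 fills only rung `m = 2`, nothing descends from dimension 4 upward". This file proves what
the hypothesis DOES reach, in every dimension, from the landed codimension-truncated pencil step
`Theorems.stub_pencilStepCodim` (p156883; de Cataldo–Migliorini Prop. 4.5 / Thomas Prop. 2 with the
hypothesis consulted only in codimension `≤ p`):

* `hodge_codim_le_two_of_hc42` — **granted HC(4;2,2), the Hodge conjecture holds in codimension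
  `≤ 2` on every smooth projective complex variety of every dimension** (induction on the dimension:
  `≤ 3` is `hodgeBelowDim_four`, `4` is points / Lefschetz `(1,1)` / the hypothesis, `m + 1 ≥ 5` is
  the truncated pencil step with `2·2 ≤ m`). New in the tree beyond dimension `5`
  (`hodgeBelowDim_six_of_hc42`): e.g. `(2,2)`-classes on sixfolds, sevenfolds, … .
* `hodge_codim_ge_of_hc42` — hence, by hard Lefschetz, in codimension `p ≥ n − 2` on every smooth
  projective `n`-fold.
* `summitGrantedFourfolds_iff_band` — **the crux is EQUIVALENT to its band**: `SummitGrantedFourfolds ↔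
  (HC(4;2,2) → ∀ n X p, 3 ≤ p → p + 3 ≤ n → rational (p,p)-classes on X are algebraic)`; the first
  instance of the band is `(6;3,3)` (cf. `summitGrantedFourfolds_iff_heartFromThree`, which reads the
  same open content through the CH₀-dichotomy of the middle step).
* `hodgeConjectureFor_five_of_hc42` — in particular HC(4;2,2) gives the Hodge conjecture for every
  smooth projective FIVEFOLD (all codimensions: `p ≤ 2` or `p ≥ 3 = 5 − 2`), the pointwise form of
  `hodgeBelowDim_six_of_hc42`.

## References

* [DecataldoMigliorini2009] M. A. de Cataldo, L. Migliorini, §4 Prop. 4.5 and its proof.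
* [Thomas2005Nodes] R. P. Thomas, Nodes and the Hodge conjecture, §2 Prop. 2.
* [KerrPearlstein2011] M. Kerr, G. Pearlstein, §3.1.
* [BrosnanFangNiePearlstein2009] P. Brosnan, H. Fang, Z. Nie, G. Pearlstein, §6 Lemma 48.
* [VoisinHodgeI2002] C. Voisin, Hodge Theory and Complex Algebraic Geometry I, Thm. 6.25.
* [Deligne2000] P. Deligne, The Hodge conjecture, Clay (2000), §1.
-/

-- `Summit.HodgeConjecture.HodgeConjecture.Theorems` is the mandated namespace (single-problem summit),
-- flagged by `linter.dupNamespace`; the lakefile turns the linter off tree-wide, restated here.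
set_option linter.dupNamespace false

noncomputable section

namespace Summit.HodgeConjecture.HodgeConjecture.Theorems

open CategoryTheory AlgebraicGeometry
open Literature.AlgebraicGeometry Literature.AlgebraicGeometry.Motives
  Literature.AlgebraicGeometry.HodgeTheory
open Summit.HodgeConjecture.HodgeConjecture.Theses.NoetherLefschetzOneUp
open RegimeSplit

/-! ### Codimension `≤ 2` in every dimension -/

/-- **Granted HC(4;2,2), the Hodge conjecture holds in codimension `≤ 2` on every smooth projective
complex variety of every dimension `n`.** Strong induction on `n`: `n ≤ 3` is the tree's
`hodgeBelowDim_four`; `n = 4` is `algebraicClasses_zero` / Lefschetz `(1,1)` / the hypothesis;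
`n = m + 1 ≥ 5` is the codimension-truncated pencil step `stub_pencilStepCodim` (`2·2 ≤ m`), whose
hypothesis — HC in codimension `≤ 2` on `m`-folds — is the induction hypothesis.
[cite: Thomas2005Nodes, §2 Prop. 2] [cite: DecataldoMigliorini2009, §4 Prop. 4.5] -/
theorem hodge_codim_le_two_of_hc42
    (h42 : ∀ ⦃X : SchemeOver ℂ⦄, IsSmoothProjective 4 X → ∀ c : complexBetti X (2 * 2),
      IsRationalClass c → IsOfHodgeType 4 X (2 * 2) 2 2 c → c ∈ algebraicClasses X 2) :
    ∀ (n : ℕ) ⦃X : SchemeOver ℂ⦄, IsSmoothProjective n X → ∀ p : ℕ, p ≤ 2 →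
      ∀ c : complexBetti X (2 * p), IsRationalClass c → IsOfHodgeType n X (2 * p) p p c →
        c ∈ algebraicClasses X p := by
  intro n
  induction n using Nat.strong_induction_on with
  | _ n ihn =>
  intro X hX p hp c hc hh
  rcases Nat.lt_or_ge n 4 with h4 | h4
  · exact hodgeBelowDim_four h4 hX p c hc hh
  rcases Nat.lt_or_ge n 5 with h5 | h5
  · obtain rfl : n = 4 := by omega
    interval_cases p
    · rw [algebraicClasses_zero]
      exact Submodule.mem_top
    · exact lefschetzOneOne_rational_holds hX c hc hh
    · exact h42 hX c hc hh
  · obtain ⟨m, rfl⟩ : ∃ m, n = m + 1 := ⟨n - 1, by omega⟩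
    exact stub_pencilStepCodim hX p
      (fun Y hY q hq c' hc' hh' ↦ ihn m (lt_add_one m) hY q (hq.trans hp) c' hc' hh') (by omega) c hc hh

/-- **Granted HC(4;2,2), the Hodge conjecture holds in codimension `p ≥ n − 2` on every smooth
projective complex `n`-fold**: for `2p ≤ n` this forces `p ≤ 2` (`hodge_codim_le_two_of_hc42`); for
`n < 2p` hard Lefschetz (`HardLefschetzNFold.mem_algebraicClasses_of_lt_holds`) reduces to codimension
`n − p ≤ 2`. [cite: KerrPearlstein2011, §3.1] [cite: VoisinHodgeI2002, Thm. 6.25] -/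
theorem hodge_codim_ge_of_hc42
    (h42 : ∀ ⦃X : SchemeOver ℂ⦄, IsSmoothProjective 4 X → ∀ c : complexBetti X (2 * 2),
      IsRationalClass c → IsOfHodgeType 4 X (2 * 2) 2 2 c → c ∈ algebraicClasses X 2)
    {n : ℕ} {X : SchemeOver ℂ} (hX : IsSmoothProjective n X) (p : ℕ) (hnp : n ≤ p + 2)
    (c : complexBetti X (2 * p)) (hc : IsRationalClass c) (hh : IsOfHodgeType n X (2 * p) p p c) :
    c ∈ algebraicClasses X p := by
  rcases Nat.lt_or_ge n (2 * p) with hlt | hge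
  · exact HardLefschetzNFold.mem_algebraicClasses_of_lt_holds hX hlt
      (fun c' hc' hh' ↦ hodge_codim_le_two_of_hc42 h42 n hX (n - p) (by omega) c' hc' hh') c hc hh
  · exact hodge_codim_le_two_of_hc42 h42 n hX p (by omega) c hc hh

/-- **Granted HC(4;2,2), the Hodge conjecture holds for every smooth projective complex FIVEFOLD**
(every codimension `p` has `p ≤ 2` or `5 ≤ p + 2`; Hodge models by `nonempty_hodgeModel_holds`).
[cite: BrosnanFangNiePearlstein2009, §6 Lemma 48] [cite: Deligne2000, §1] -/
theorem hodgeConjectureFor_five_of_hc42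
    (h42 : ∀ ⦃X : SchemeOver ℂ⦄, IsSmoothProjective 4 X → ∀ c : complexBetti X (2 * 2),
      IsRationalClass c → IsOfHodgeType 4 X (2 * 2) 2 2 c → c ∈ algebraicClasses X 2)
    {X : SchemeOver ℂ} (hX : IsSmoothProjective 5 X) : HodgeConjectureFor 5 X := by
  refine ⟨(nonempty_hodgeModel_holds (n := 5) (X := X)).nonempty hX, fun p c hc hh ↦ ?_⟩
  by_cases hp : p ≤ 2
  · exact hodge_codim_le_two_of_hc42 h42 5 hX p hp c hc hh
  · exact hodge_codim_ge_of_hc42 h42 hX p (by omega) c hc hh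

/-! ### The crux is its band `3 ≤ p ≤ n − 3` -/

/-- **`SummitGrantedFourfolds` ↔ its band.** The crux (`HC(4;2,2) → HodgeConjecture`) is EQUIVALENT
to: granted HC(4;2,2), for every smooth projective complex `n`-fold `X` and every codimension `p` with
`3 ≤ p ≤ n − 3`, every rational `(p,p)`-class on `X` is algebraic. (→) specialisation. (←) outside the
band HC(4;2,2) already decides (`hodge_codim_le_two_of_hc42`, `hodge_codim_ge_of_hc42`); Hodge models
exist unconditionally. The first instance of the band is `(n, p) = (6, 3)`.
[cite: KerrPearlstein2011, §3.1] [cite: Deligne2000, §1] -/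
theorem summitGrantedFourfolds_iff_band :
    Summit.HodgeConjecture.HodgeConjecture.Theses.NoetherLefschetzOneUp.SummitGrantedFourfolds ↔ ((∀ ⦃X : Literature.AlgebraicGeometry.Motives.SchemeOver ℂ⦄, Literature.AlgebraicGeometry.Motives.IsSmoothProjective 4 X → ∀ c : Literature.AlgebraicGeometry.HodgeTheory.complexBetti X (2 * 2), Literature.AlgebraicGeometry.HodgeTheory.IsRationalClass c → Literature.AlgebraicGeometry.HodgeTheory.IsOfHodgeType 4 X (2 * 2) 2 2 c → c ∈ Literature.AlgebraicGeometry.HodgeTheory.algebraicClasses X 2) → ∀ ⦃n : ℕ⦄ ⦃X : Literature.AlgebraicGeometry.Motives.SchemeOver ℂ⦄, Literature.AlgebraicGeometry.Motives.IsSmoothProjective n X → ∀ (p : ℕ), 3 ≤ p → p + 3 ≤ n → ∀ c : Literature.AlgebraicGeometry.HodgeTheory.complexBetti X (2 * p), Literature.AlgebraicGeometry.HodgeTheory.IsRationalClass c → Literature.AlgebraicGeometry.HodgeTheory.IsOfHodgeType n X (2 * p) p p c → c ∈ Literature.AlgebraicGeometry.HodgeTheory.algebraicClasses X p) := by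
  constructor
  · intro hS h42 n X hX p _ _ c hc hh
    exact (hS h42 hX).2 p c hc hh
  · intro hB
    unfold Summit.HodgeConjecture.HodgeConjecture.Theses.NoetherLefschetzOneUp.SummitGrantedFourfolds
    intro h42 n X hX
    refine ⟨(nonempty_hodgeModel_holds (n := n) (X := X)).nonempty hX, fun p c hc hh ↦ ?_⟩
    by_cases hp : p ≤ 2
    · exact hodge_codim_le_two_of_hc42 h42 n hX p hp c hc hh
    by_cases hn : n ≤ p + 2
    · exact hodge_codim_ge_of_hc42 h42 hX p hn c hc hh
    · exact hB h42 hX p (by omega) (by omega) c hc hh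

end Summit.HodgeConjecture.HodgeConjecture.Theorems

end
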